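import Summits.HubbardSuperconductivity.HubbardSuperconductivity.Theorems.WeakCouplingBCSWcbcsSsbToTorusLROFejerClosure
import Literature.MathematicalPhysics.QuantumLattice.PairFieldMomentum
import Literature.MathematicalPhysics.QuantumLattice.PairCorrelationsProofs
import Literature.Probability.LatticeModels.FejerKernel
import HarnessLib

/-!
# Route `FunctionFieldCertificate` — Fejér glue for the Assembly (item `stmt-HubbardSuperconductivity-7335`), file 1 of 2

Helper file (lands `--supports stmt-HubbardSuperconductivity-7335`; the closing module is
`Theorems/FunctionFieldCertificateAssembly.lean`). The route's Assembly glues the pole-free half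
`MesoscopicPairOrder` (a lower bound `m R²` on the Fejér-box average
`T_R(ψ)/L² = L⁻² Σ_{x,y} Πᵢ (1 - |(y - x)ᵢ|_L/R)₊ Re⟨P_x ψ, P_y ψ⟩` of the `d`-wave pair correlation)
and the pole half `WindowInfraredBound` (the window pair weight `Σ_{m ≠ 0, |q_m| ≤ ε} S_ψ(m) ≤ CεL²`)
into zero-momentum pair order by a Fejér–Parseval identity on the dual torus. The Fourier half of
that identity is already a tree theorem — the Fejér closure
`WcbcsSsbToTorusLRO.stub_fejerClosure` of route WeakCouplingBCS
(`Σ_a ‖B_a ψ‖²/(R⁴L²) - Σ_{m ≠ 0, |q_m|² < η²} S_ψ(m)/L² - 2π²C_g²/(R²η²) ≤ Re⟨ψ, Δ_gᴴΔ_g ψ⟩/L⁴`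
for the blocks `B_a = Σ_{u ∈ [0,R)²} P_{a+u}`). What this file adds is the REAL-SPACE half:

* `fejerCount_eq_max` — the Fejér counts of `FejerKernel.lean` exactly, `c_R(k) = (R - |k|)₊`
  (the tree had `c_R(0) = R`, `c_R ≤ R`, `c_R ≥ R - |k|`, `c_R(k) = 0` for `|k| ≥ R`);
* `sum_sum_ite_eq_max`, `sum_sum_ite_eq_prod_max` — the block-pair count on the torus: for
  `2R ≤ L`, `#{(u, u') ∈ ([0,R)^d)² : u' - u ≡ z} = Πᵢ (R - |zᵢ|_L)₊` (`|·|_L = |valMinAbs ·|`; no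
  wrap-around below half the side, `natCast_sub_natCast_eq_iff`);
* `sum_blockSum_eq`, `sum_star_blockMulVec_dotProduct`, `re_sum_star_blockMulVec_dotProduct_eq` —
  the TENT IDENTITY `Σ_a ⟨B_a ψ, B_a ψ⟩ = Σ_{x,y} Πᵢ (R - |(y-x)ᵢ|_L)₊ ⟨P_x ψ, P_y ψ⟩ = R² T_R(ψ)`
  for any family of matrices `P_x` on `(ℤ/Lℤ)^d` and any vector `ψ` (no translation invariance);
* `fejer_glue` — the fixed-side inequality the Assembly consumes:
  `T_R(ψ)/(R²L²) - Σ_{m ≠ 0, |q_m|² < η²} S_ψ(m)/L² - 2π²C_g²/(R²η²) ≤ Re⟨ψ, Δ_gᴴΔ_g ψ⟩/L⁴`.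

Sources: Kennedy–Lieb–Shastry, PRL 61 (1988) 2582 (Fourier modes of an order operator, Parseval
sum rule) [KLS1988PRL]; Stein–Shakarchi, *Fourier Analysis*, Ch. 2 (the Fejér kernel as the
autocorrelation of a box); Friedli–Velenik (2017) §10.4 (Fourier analysis on `(ℤ/Lℤ)^d`). All
statements are folklore; no definition is introduced; nothing here mentions the Hubbard
Hamiltonian (the glue is model-free). Deliberately NOT here: the `liminf` bookkeeping and the choice
of constants (file 2), any evaluation of `C_g` (only its finiteness is used).
-/

noncomputable section

-- the summit namespace `Summit.HubbardSuperconductivity.HubbardSuperconductivity.…` repeats the problem name by design (D-0017)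
set_option linter.dupNamespace false

namespace Summit.HubbardSuperconductivity.HubbardSuperconductivity.Theorems.FunctionFieldCertificateAssembly

open Matrix Finset Filter
open Literature.Probability.LatticeModels Literature.MathematicalPhysics.QuantumLattice
open scoped ComplexConjugate ComplexOrder

/-! ### The Fejér counts, exactly -/

section Count

/-- `c_R(k) ≤ R - |k|` for `|k| ≤ R`: for `k ≥ 0` the fiber `{(n, m) ∈ [0,R)² : n - m = k}` is
the image of `[0, R - k)` under `m ↦ (m + k, m)`; `k < 0` by the symmetry `c_R(-k) = c_R(k)`.
[folklore] -/
theorem fejerCount_le_sub (R : ℕ) (k : ℤ) (hk : |k| ≤ R) : (fejerCount R k : ℤ) ≤ R - |k| := by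
  wlog hk0 : 0 ≤ k generalizing k
  · have := this (-k) (by rwa [abs_neg]) (by omega)
    rwa [fejerCount_neg, abs_neg] at this
  rw [abs_of_nonneg hk0] at hk ⊢
  unfold fejerCount
  have hsub : ((Finset.range R ×ˢ Finset.range R).filter fun nm => (nm.1 : ℤ) - nm.2 = k) ⊆
      (Finset.range (R - k.toNat)).image (fun m => (m + k.toNat, m)) := by
    intro nm hnm
    simp only [Finset.mem_filter, Finset.mem_product, Finset.mem_range] at hnm
    simp only [Finset.mem_image, Finset.mem_range]
    refine ⟨nm.2, by omega, ?_⟩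
    have : nm.2 + k.toNat = nm.1 := by omega
    rw [this]
  have hcard := Finset.card_le_card hsub
  have himg : ((Finset.range (R - k.toNat)).image (fun m => (m + k.toNat, m))).card ≤ R - k.toNat :=
    Finset.card_image_le.trans (Finset.card_range _).le
  have h := hcard.trans himg
  have hkR : k.toNat ≤ R := by omega
  calc ((((Finset.range R ×ˢ Finset.range R).filter fun nm => (nm.1 : ℤ) - nm.2 = k).card : ℕ) : ℤ)
      ≤ ((R - k.toNat : ℕ) : ℤ) := by exact_mod_cast h
    _ = R - k := by rw [Nat.cast_sub hkR, Int.toNat_of_nonneg hk0]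

/-- **The Fejér counts exactly**: `c_R(k) = (R - |k|)₊`. [folklore] -/
theorem fejerCount_eq_max (R : ℕ) (k : ℤ) : (fejerCount R k : ℤ) = max 0 ((R : ℤ) - |k|) := by
  rcases le_or_gt (R : ℤ) |k| with h | h
  · rw [fejerCount_eq_zero_of_le h, max_eq_left (by omega)]
    simp
  · rw [max_eq_right (by omega)]
    exact le_antisymm (fejerCount_le_sub R k h.le) (sub_le_fejerCount R k)

/-- The Fejér count as a double indicator sum over `[0, R)²`:
`Σ_{v<R} Σ_{v'<R} [v' - v = k] = c_R(k)`. [folklore] -/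
theorem sum_sum_ite_sub_eq_fejerCount (R : ℕ) (k : ℤ) :
    (∑ v ∈ Finset.range R, ∑ v' ∈ Finset.range R, if (v' : ℤ) - v = k then (1 : ℂ) else 0) =
      (fejerCount R k : ℂ) := by
  rw [Finset.sum_comm, ← Finset.sum_product (s := Finset.range R) (t := Finset.range R)
    (f := fun nm => if (nm.1 : ℤ) - nm.2 = k then (1 : ℂ) else 0), Finset.sum_boole]
  rfl

variable {L : ℕ} [NeZero L]

/-- **No wrap-around below half the side.** For `v, v' < R` with `2R ≤ L`, the congruence
`v' - v ≡ t (mod L)` holds iff `v' - v` IS the representative of `t` of least absolute value.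
[folklore] -/
theorem natCast_sub_natCast_eq_iff {R : ℕ} (hRL : 2 * R ≤ L) {v v' : ℕ} (hv : v < R) (hv' : v' < R)
    (t : ZMod L) : ((v' : ZMod L) - (v : ZMod L) = t) ↔ ((v' : ℤ) - v = t.valMinAbs) := by
  rw [eq_comm (b := t.valMinAbs), ZMod.valMinAbs_spec]
  push_cast
  constructor
  · intro h
    refine ⟨h.symm, ?_, ?_⟩ <;> omega
  · intro h
    exact h.1.symm

/-- **One-dimensional block-pair count.** For `2R ≤ L` and `t ∈ ℤ/Lℤ`:
`#{(v, v') ∈ [0,R)² : v' - v ≡ t} = (R - |t|_L)₊`, `|t|_L = |valMinAbs t|`. [folklore] -/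
theorem sum_sum_ite_eq_max (R : ℕ) (hRL : 2 * R ≤ L) (t : ZMod L) :
    (∑ v : Fin R, ∑ v' : Fin R, if ((v' : ℕ) : ZMod L) - ((v : ℕ) : ZMod L) = t then (1 : ℂ) else 0) =
      ((max 0 ((R : ℤ) - |t.valMinAbs|) : ℤ) : ℂ) := by
  rw [← fejerCount_eq_max, Int.cast_natCast, ← sum_sum_ite_sub_eq_fejerCount]
  rw [Fin.sum_univ_eq_sum_range (fun v => ∑ v' : Fin R,
      if ((v' : ℕ) : ZMod L) - ((v : ℕ) : ZMod L) = t then (1 : ℂ) else 0) R]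
  refine Finset.sum_congr rfl fun v hv => ?_
  rw [Fin.sum_univ_eq_sum_range (fun v' =>
      if ((v' : ℕ) : ZMod L) - ((v : ℕ) : ZMod L) = t then (1 : ℂ) else 0) R]
  refine Finset.sum_congr rfl fun v' hv' => ?_
  rw [Finset.mem_range] at hv hv'
  simp only [natCast_sub_natCast_eq_iff hRL hv hv' t]

omit [NeZero L] in
/-- **The `d`-dimensional count factorises**:
`#{(u, u') ∈ ([0,R)^d)² : u' - u ≡ z} = Πᵢ #{(v, v') ∈ [0,R)² : v' - v ≡ zᵢ}`. [folklore] -/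
theorem sum_sum_ite_eq_prod {d : ℕ} (R : ℕ) (z : TorusSite d L) :
    (∑ u : Fin d → Fin R, ∑ u' : Fin d → Fin R,
        if ((fun i => ((u' i : ℕ) : ZMod L)) - fun i => ((u i : ℕ) : ZMod L)) = z then (1 : ℂ) else 0) =
      ∏ i, ∑ v : Fin R, ∑ v' : Fin R,
        if ((v' : ℕ) : ZMod L) - ((v : ℕ) : ZMod L) = z i then (1 : ℂ) else 0 := by
  rw [Fintype.prod_sum]
  refine Finset.sum_congr rfl fun u _ => ?_
  rw [Fintype.prod_sum]
  refine Finset.sum_congr rfl fun u' _ => ?_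
  rw [Fintype.prod_boole]
  congr 1
  simp only [funext_iff, Pi.sub_apply]

/-- **Block-pair count on the torus** (`2R ≤ L`):
`#{(u, u') ∈ ([0,R)^d)² : u' - u ≡ z} = Πᵢ (R - |zᵢ|_L)₊`. [folklore] -/
theorem sum_sum_ite_eq_prod_max {d : ℕ} (R : ℕ) (hRL : 2 * R ≤ L) (z : TorusSite d L) :
    (∑ u : Fin d → Fin R, ∑ u' : Fin d → Fin R,
        if ((fun i => ((u' i : ℕ) : ZMod L)) - fun i => ((u i : ℕ) : ZMod L)) = z then (1 : ℂ) else 0) =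
      ((∏ i, max 0 ((R : ℤ) - |(z i).valMinAbs|) : ℤ) : ℂ) := by
  rw [sum_sum_ite_eq_prod, Int.cast_prod]
  exact Finset.prod_congr rfl fun i _ => sum_sum_ite_eq_max R hRL (z i)

end Count

/-! ### The tent identity: block sums are Fejér-weighted correlation sums -/

section Tent

variable {d L : ℕ} [NeZero L]

/-- Translation reindexing on the torus: `Σ_a K(a + u, a + u') = Σ_x K(x, x + (u' - u))`. [folklore] -/
theorem sum_translate (K : TorusSite d L → TorusSite d L → ℂ) (u u' : TorusSite d L) :
    ∑ a : TorusSite d L, K (a + u) (a + u') = ∑ x : TorusSite d L, K x (x + (u' - u)) := by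
  refine Fintype.sum_equiv (Equiv.addRight u) _ _ fun a => ?_
  simp only [Equiv.coe_addRight]
  congr 1
  abel

/-- Diagonal reindexing: `Σ_x Σ_y N(y - x) K(x, y) = Σ_z N(z) Σ_x K(x, x + z)`. [folklore] -/
theorem sum_sum_sub_mul (N : TorusSite d L → ℂ) (K : TorusSite d L → TorusSite d L → ℂ) :
    ∑ x : TorusSite d L, ∑ y : TorusSite d L, N (y - x) * K x y =
      ∑ z : TorusSite d L, N z * ∑ x : TorusSite d L, K x (x + z) := by
  have h : ∀ x : TorusSite d L, ∑ y, N (y - x) * K x y = ∑ z, N z * K x (x + z) := fun x => by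
    refine Fintype.sum_equiv (Equiv.subRight x) _ _ fun y => ?_
    simp only [Equiv.subRight_apply, add_sub_cancel]
  simp_rw [h]
  rw [Finset.sum_comm]
  simp_rw [Finset.mul_sum]

/-- **The tent identity** (`2R ≤ L`, any kernel `K` on the torus `(ℤ/Lℤ)^d`): summing `K` over all
pairs of points of all translates of the block `[0,R)^d`,
`Σ_a Σ_{u,u' ∈ [0,R)^d} K(a + u, a + u') = Σ_{x,y} Πᵢ (R - |(y - x)ᵢ|_L)₊ · K(x, y)` — the number of
(block, offset, offset) triples hitting `(x, y)` is the block-pair count of `y - x`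
(`sum_sum_ite_eq_prod_max`), i.e. `R^d` times the Fejér (tent) weight `Πᵢ (1 - |(y-x)ᵢ|_L/R)₊`.
Stein–Shakarchi, *Fourier Analysis*, Ch. 2 (Fejér kernel as the autocorrelation of a box). [folklore] -/
theorem sum_blockSum_eq (R : ℕ) (hRL : 2 * R ≤ L) (K : TorusSite d L → TorusSite d L → ℂ) :
    ∑ a : TorusSite d L, ∑ u : Fin d → Fin R, ∑ u' : Fin d → Fin R,
        K (a + fun i => ((u i : ℕ) : ZMod L)) (a + fun i => ((u' i : ℕ) : ZMod L)) =
      ∑ x : TorusSite d L, ∑ y : TorusSite d L,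
        ((∏ i, max 0 ((R : ℤ) - |(y i - x i).valMinAbs|) : ℤ) : ℂ) * K x y := by
  -- the kernel summed along a diagonal
  set G : TorusSite d L → ℂ := fun z => ∑ x, K x (x + z) with hG
  -- Step 1: translate each block to the origin
  have h1 : (∑ a : TorusSite d L, ∑ u : Fin d → Fin R, ∑ u' : Fin d → Fin R,
      K (a + fun i => ((u i : ℕ) : ZMod L)) (a + fun i => ((u' i : ℕ) : ZMod L))) =
      ∑ u : Fin d → Fin R, ∑ u' : Fin d → Fin R,
        G ((fun i => ((u' i : ℕ) : ZMod L)) - fun i => ((u i : ℕ) : ZMod L)) := by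
    rw [Finset.sum_comm]
    refine Finset.sum_congr rfl fun u _ => ?_
    rw [Finset.sum_comm]
    refine Finset.sum_congr rfl fun u' _ => ?_
    exact sum_translate K _ _
  -- Step 2: collect the pairs `(u, u')` along their difference
  have h2 : (∑ u : Fin d → Fin R, ∑ u' : Fin d → Fin R,
      G ((fun i => ((u' i : ℕ) : ZMod L)) - fun i => ((u i : ℕ) : ZMod L))) =
      ∑ z : TorusSite d L, (∑ u : Fin d → Fin R, ∑ u' : Fin d → Fin R,
        if ((fun i => ((u' i : ℕ) : ZMod L)) - fun i => ((u i : ℕ) : ZMod L)) = z then (1 : ℂ) else 0) *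
          G z := by
    calc (∑ u : Fin d → Fin R, ∑ u' : Fin d → Fin R,
          G ((fun i => ((u' i : ℕ) : ZMod L)) - fun i => ((u i : ℕ) : ZMod L)))
        = ∑ u : Fin d → Fin R, ∑ u' : Fin d → Fin R, ∑ z : TorusSite d L,
            if ((fun i => ((u' i : ℕ) : ZMod L)) - fun i => ((u i : ℕ) : ZMod L)) = z then G z
            else 0 := by
          simp only [Fintype.sum_ite_eq]
      _ = ∑ u : Fin d → Fin R, ∑ z : TorusSite d L, ∑ u' : Fin d → Fin R,
            if ((fun i => ((u' i : ℕ) : ZMod L)) - fun i => ((u i : ℕ) : ZMod L)) = z then G z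
            else 0 := Finset.sum_congr rfl fun u _ => Finset.sum_comm
      _ = ∑ z : TorusSite d L, ∑ u : Fin d → Fin R, ∑ u' : Fin d → Fin R,
            if ((fun i => ((u' i : ℕ) : ZMod L)) - fun i => ((u i : ℕ) : ZMod L)) = z then G z
            else 0 := Finset.sum_comm
      _ = _ := by
          refine Finset.sum_congr rfl fun z _ => ?_
          rw [Finset.sum_mul]
          refine Finset.sum_congr rfl fun u _ => ?_
          rw [Finset.sum_mul]
          refine Finset.sum_congr rfl fun u' _ => ?_
          rw [ite_mul, one_mul, zero_mul]
  -- Step 3: count, and undo the diagonal reindexing on the right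
  have h3 := sum_sum_sub_mul
    (fun z : TorusSite d L => ((∏ i, max 0 ((R : ℤ) - |(z i).valMinAbs|) : ℤ) : ℂ)) K
  dsimp only [Pi.sub_apply] at h3
  rw [h1, h2, h3]
  refine Finset.sum_congr rfl fun z _ => ?_
  rw [sum_sum_ite_eq_prod_max R hRL z]

/-- **The tent identity for block sums of a vector family.** For any family of square matrices
`P_x` on the torus, blocks `B_a = Σ_{u ∈ [0,R)^d} P_{a+u}` (`2R ≤ L`) and any vector `ψ`:
`Σ_a ⟨B_a ψ, B_a ψ⟩ = Σ_{x,y} Πᵢ (R - |(y - x)ᵢ|_L)₊ ⟨P_x ψ, P_y ψ⟩`. [folklore] -/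
theorem sum_star_blockMulVec_dotProduct {n : Type*} [Fintype n] (R : ℕ) (hRL : 2 * R ≤ L)
    (P : TorusSite d L → Matrix n n ℂ) (ψ : n → ℂ) :
    ∑ a : TorusSite d L, star ((∑ u : Fin d → Fin R, P (a + fun i => ((u i : ℕ) : ZMod L))) *ᵥ ψ) ⬝ᵥ
        ((∑ u : Fin d → Fin R, P (a + fun i => ((u i : ℕ) : ZMod L))) *ᵥ ψ) =
      ∑ x : TorusSite d L, ∑ y : TorusSite d L,
        ((∏ i, max 0 ((R : ℤ) - |(y i - x i).valMinAbs|) : ℤ) : ℂ) *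
          (star (P x *ᵥ ψ) ⬝ᵥ (P y *ᵥ ψ)) := by
  rw [← sum_blockSum_eq R hRL (fun x y => star (P x *ᵥ ψ) ⬝ᵥ (P y *ᵥ ψ))]
  refine Finset.sum_congr rfl fun a _ => ?_
  rw [Matrix.sum_mulVec, star_sum, sum_dotProduct]
  refine Finset.sum_congr rfl fun u _ => ?_
  rw [dotProduct_sum]

/-- `(R - |s|)₊ = R · (1 - |s|/R)₊` for `R > 0` (casts from `ℤ`). [folklore] -/
theorem intCast_max_sub_abs (R : ℕ) (hR : (0 : ℝ) < R) (s : ℤ) :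
    ((max 0 ((R : ℤ) - |s|) : ℤ) : ℝ) = R * max 0 (1 - |(s : ℝ)| / R) := by
  rw [Int.cast_max, Int.cast_zero, Int.cast_sub, Int.cast_natCast, Int.cast_abs,
    mul_max_of_nonneg _ _ hR.le, mul_zero]
  congr 1
  field_simp

/-- **Real form, `d = 2`, Fejér normalisation.** With `R > 0`, `2R ≤ L`:
`Σ_a Re⟨B_a ψ, B_a ψ⟩ = R² · Σ_{x,y} Πᵢ (1 - |(y - x)ᵢ|_L / R)₊ · Re⟨P_x ψ, P_y ψ⟩` — the right-hand
double sum is literally the Fejér-box average of route item `MesoscopicPairOrder`. [folklore] -/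
theorem re_sum_star_blockMulVec_dotProduct_eq {n : Type*} [Fintype n] (R : ℕ) (hR : 0 < R)
    (hRL : 2 * R ≤ L) (P : TorusSite 2 L → Matrix n n ℂ) (ψ : n → ℂ) :
    (∑ a : TorusSite 2 L, star ((∑ u : Fin 2 → Fin R, P (a + fun i => ((u i : ℕ) : ZMod L))) *ᵥ ψ) ⬝ᵥ
        ((∑ u : Fin 2 → Fin R, P (a + fun i => ((u i : ℕ) : ZMod L))) *ᵥ ψ)).re =
      (R : ℝ) ^ 2 * ∑ x : TorusSite 2 L, ∑ y : TorusSite 2 L,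
        (∏ i : Fin 2, max 0 (1 - |(((y i - x i).valMinAbs : ℤ) : ℝ)| / (R : ℝ))) *
          (star (P x *ᵥ ψ) ⬝ᵥ (P y *ᵥ ψ)).re := by
  have hRpos : (0 : ℝ) < R := Nat.cast_pos.2 hR
  rw [sum_star_blockMulVec_dotProduct R hRL P ψ, Complex.re_sum, Finset.mul_sum]
  refine Finset.sum_congr rfl fun x _ => ?_
  rw [Complex.re_sum, Finset.mul_sum]
  refine Finset.sum_congr rfl fun y _ => ?_
  rw [← Complex.ofReal_intCast, Complex.re_ofReal_mul, ← mul_assoc]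
  congr 1
  rw [Int.cast_prod, Fin.prod_univ_two, Fin.prod_univ_two, intCast_max_sub_abs R hRpos,
    intCast_max_sub_abs R hRpos]
  ring

end Tent

/-! ### The fixed-side Fejér glue -/

section FixedSide

/-- **Fixed-side Fejér glue** (the Assembly's analytic core at one even side `L`). For a form
factor `g`, a block scale `R > 0` with `2R ≤ L`, a window `η > 0` and a unit vector `ψ`:
`T_R(ψ)/(R²L²) - Σ_{m ≠ 0, |q_m|² < η²} S_ψ(m)/L² - 2π² C_g²/(R² η²) ≤ Re⟨ψ, Δ_gᴴ Δ_g ψ⟩/L⁴`, where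
`T_R(ψ) = Σ_{x,y} Πᵢ (1 - |(y - x)ᵢ|_L/R)₊ Re⟨P_x ψ, P_y ψ⟩` is the Fejér-box pair correlation of
`MesoscopicPairOrder`, `S_ψ = pairStructureFactor g L ψ` and `C_g = Σ_e 2|g e|/√2`. This is the
Fejér closure `WcbcsSsbToTorusLRO.stub_fejerClosure` (block Plancherel + kernel bounds + sum rule)
with its block term rewritten by the tent identity `re_sum_star_blockMulVec_dotProduct_eq`
(`Σ_a ‖B_a ψ‖² = R² T_R(ψ)`). Kennedy–Lieb–Shastry, PRL 61 (1988) 2582 (Parseval bookkeeping);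
Stein–Shakarchi, *Fourier Analysis*, Ch. 2 (Fejér kernel). [folklore] -/
theorem fejer_glue (g : Site 2 → ℝ) (L : ℕ) [NeZero L] (R : ℕ) (hR : 0 < R) (hRL : 2 * R ≤ L)
    (η : ℝ) (hη : 0 < η) (ψ : Fock (Orb (FermionTorus 2 L))) (hψ : star ψ ⬝ᵥ ψ = 1) :
    (∑ x : TorusSite 2 L, ∑ y : TorusSite 2 L,
        (∏ i : Fin 2, max 0 (1 - |(((y i - x i).valMinAbs : ℤ) : ℝ)| / (R : ℝ))) *
          (star (localPair g L x *ᵥ ψ) ⬝ᵥ (localPair g L y *ᵥ ψ)).re) / ((R : ℝ) ^ 2 * (L : ℝ) ^ 2) -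
      (∑ m ∈ (Finset.univ.filter fun m : TorusSite 2 L => m ≠ 0 ∧ momentumNormSq L m < η ^ 2),
          pairStructureFactor g L ψ m) / (L : ℝ) ^ 2 -
      2 * Real.pi ^ 2 * (∑ e ∈ insert (0 : Site 2) unitSteps, ‖((g e / Real.sqrt 2 : ℝ) : ℂ)‖ * 2) ^ 2 /
        ((R : ℝ) ^ 2 * η ^ 2) ≤
      (expect ((pairField g L)ᴴ * pairField g L) ψ).re / (L : ℝ) ^ 4 := by
  have h := WcbcsSsbToTorusLRO.stub_fejerClosure g L R hR η hη ψ hψ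
  rw [re_sum_star_blockMulVec_dotProduct_eq R hR hRL (localPair g L) ψ] at h
  have hRpos : (0 : ℝ) < R := Nat.cast_pos.2 hR
  have hLpos : (0 : ℝ) < L := Nat.cast_pos.2 (Nat.pos_of_ne_zero (NeZero.ne L))
  have e : ∀ T : ℝ, (R : ℝ) ^ 2 * T / ((R : ℝ) ^ 4 * (L : ℝ) ^ 2) = T / ((R : ℝ) ^ 2 * (L : ℝ) ^ 2) := by
    intro T
    field_simp
  rw [e] at h
  exact h

end FixedSide

end Summit.HubbardSuperconductivity.HubbardSuperconductivity.Theorems.FunctionFieldCertificateAssembly
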